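import Summits.RiemannHypothesis.RiemannHypothesis.Theses.JensenQuinticWedge
import Summits.RiemannHypothesis.RiemannHypothesis.Theorems.JensenAlphaCorollary
import HarnessLib

/-!
# Route JensenQuinticWedge (L27, RECORD) — `Assembly` (item stmt-RiemannHypothesis-21559)

`FifthOrderMultiplierStability → XiFiveMatchedModel → TheoremAlpha`: its conclusion, the rung leaf J-P(P1)
`JensenPolynomials.TheoremAlpha` (THEOREM α), is now a tree theorem — `JensenPolynomials.theoremAlpha_of_sqrtLogRange`
(Theorems/JensenAlphaCorollary.lean, rh-idea-8 g0: corollary of the PROVED P1″ leaf `KimLee.jensenSqrtLogRangeTwenty_holds`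
+ the `d ≤ 10⁶` all-shift certificate; RH-free, standard axioms) — so the Assembly holds outright and the route is
RECORD-only (critic idea-crit-2 21:02:03Z). RH-free proof-of-data inside Farmer's barrier class; nothing here bears on
the zeros of ζ or the truth of RH.
-/

-- D-0017: `Summit.RiemannHypothesis.RiemannHypothesis.…` duplicates the namespace BY DESIGN (single-problem summit).
set_option linter.dupNamespace false

namespace Summit.RiemannHypothesis.RiemannHypothesis.Theorems.JensenQuinticWedge

/-- **`Assembly` (item stmt-RiemannHypothesis-21559) holds**: its conclusion `TheoremAlpha` is the tree theorem
`JensenPolynomials.theoremAlpha_of_sqrtLogRange` (the two hypotheses are not needed). RH-free. -/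
theorem assembly_proof :
    Summit.RiemannHypothesis.RiemannHypothesis.Theses.JensenQuinticWedge.Assembly :=
  fun _ _ ↦ JensenPolynomials.theoremAlpha_of_sqrtLogRange

end Summit.RiemannHypothesis.RiemannHypothesis.Theorems.JensenQuinticWedge
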